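import Mathlib
import Literature.MathematicalPhysics.QuantumLattice.DWaveOrderParameterProofs

/-! Triage scratch (triager 3, round 1, crux WcbcsBcsConstruction).
(1) idea source-staircase-nambu-dirac, first lemma `staircase_reduction`:
    `ε ≤ dWaveOrderParameter U μ ↔ ∀ h ∈ (0,h₀), ε ≤ liminf_L dWaveSourceDensity (L+1) U μ h`
    — already a two-line consequence of the LANDED API (p68681).
(2) idea gap-inequality-bootstrap, first lemma `gap_inequality_floor` (my own rendering):
    the algebra `x ≥ η·a·g·x·log(W/(h+gx))`, `x > 0` ⇒ `h + g x ≥ W exp(-1/(η a g))`. -/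

open Filter Literature.MathematicalPhysics.QuantumLattice

-- (1) staircase reduction from the landed levers
example (U μ ε h₀ : ℝ) (hh₀ : 0 < h₀) :
    ε ≤ dWaveOrderParameter U μ ↔
      ∀ h ∈ Set.Ioo 0 h₀, ε ≤ liminf (fun L : ℕ => dWaveSourceDensity (L + 1) U μ h) atTop := by
  constructor
  · intro hε h hh
    exact hε.trans (dWaveOrderParameter_le_liminf U μ hh.1)
  · exact le_dWaveOrderParameter_of_forall U μ hh₀

-- (2) the gap-inequality floor (pure algebra)
example (x η a g W h : ℝ) (hx : 0 < x) (hη : 0 < η) (ha : 0 < a) (hg : 0 < g) (hW : 0 < W)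
    (hh : 0 ≤ h)
    (sci : η * a * g * x * Real.log (W / (h + g * x)) ≤ x) :
    W * Real.exp (-(1 / (η * a * g))) ≤ h + g * x := by
  have hpos : 0 < h + g * x := by positivity
  have hηag : 0 < η * a * g := by positivity
  -- divide the SCI by x > 0 and by ηag > 0
  have h1 : Real.log (W / (h + g * x)) ≤ 1 / (η * a * g) := by
    have : η * a * g * Real.log (W / (h + g * x)) ≤ 1 := by
      have h2 : (η * a * g * Real.log (W / (h + g * x))) * x ≤ 1 * x := by nlinarith [sci]
      exact le_of_mul_le_mul_right h2 hx
    rw [le_div_iff₀ hηag]; linarith [this]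
  -- exponentiate
  have h3 : W / (h + g * x) ≤ Real.exp (1 / (η * a * g)) := by
    have := Real.exp_le_exp.mpr h1
    rwa [Real.exp_log (by positivity)] at this
  rw [div_le_iff₀ hpos] at h3
  rw [Real.exp_neg]
  have hE : 0 < Real.exp (1 / (η * a * g)) := Real.exp_pos _
  calc W * (Real.exp (1 / (η * a * g)))⁻¹
      ≤ (Real.exp (1 / (η * a * g)) * (h + g * x)) * (Real.exp (1 / (η * a * g)))⁻¹ := by
        gcongr
    _ = h + g * x := by field_simp
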